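import Summits.Ventures.HodgeRepro2.T5SU11JacobiPhaseLawRate
import Summits.Ventures.HodgeRepro2.T5SU11JacobiWeightDerivAll

/-!
# The moments of the phase pinned, uniformly in `0 ≤ λ ≤ 2`: `|k ⟨log|a|⟩_{k,λ} − 1| ≤ 7/k`, `|k² ⟨(log|a|)²⟩_{k,λ} − 2| ≤ 48/k`

`T5SU11JacobiMeanPhaseAsymptotic` proves `k ⟨log|a|⟩_{k,λ} → 1` and `T5SU11JacobiPhaseMomentsAsymptotic`
`kⁿ ⟨(log|a|)ⁿ⟩_{k,λ} → n!`, by squeezes and dominated convergence. With the Lipschitz bound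
`1 − c s ≤ Φ_λ(s) ≤ 1`, `c = λ(2 − λ)/2 ≤ 1/2` (`T5SU11JacobiPhaseLipschitz`, `0 ≤ λ ≤ 2`), every moment
integral of the phase is pinned between two Euler integrals:

  **`n!/(k−2)^{n+1} − c (n+1)!/(k−2)^{n+2} ≤ ∫_0^∞ sⁿ e^{−(k−2)s} Φ_λ(s) ds ≤ n!/(k−2)^{n+1}`**
  (`le_moment_phase`, `moment_phase_le`),

and, through `⟨(log|a|)ⁿ⟩_{k,λ} = ∫ sⁿ e^{−(k−2)s} Φ_λ / ∫ e^{−(k−2)s} Φ_λ` (`normalized_moment_eq_phase`,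
`T5SU11JacobiWeightDerivAll` + `T5SU11JacobiLaplacePhase`) and the mass bounds of `T5SU11JacobiPhaseLawRate`,

  **`n!/(k−2)ⁿ − c (n+1)!/(k−2)^{n+1} ≤ ⟨(log|a|)ⁿ⟩_{k,λ} ≤ n!/((k−2)ⁿ (1 − c/(k−2)))`**
  (`le_normalized_moment`, `normalized_moment_le`),

hence, for `k ≥ 4`, the **rates** `|k ⟨log|a|⟩_{k,λ} − 1| ≤ 7/k` (`abs_mul_mean_phase_sub_one_le`),
`|k² ⟨(log|a|)²⟩_{k,λ} − 2| ≤ 48/k` (`abs_sq_mul_second_moment_sub_two_le`) and `|k² Var_{k,λ}(log|a|) − 1| ≤ 75/k`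
(`abs_sq_mul_variance_phase_sub_one_le`), with constants uniform in `λ ∈ [0, 2]`; at `λ = 0` the moments are exactly `n!/(k−2)ⁿ` (`T5SU11PhaseLawLintegral`). Nothing is claimed
about (N).

Blind lane: Mathlib + the HodgeRepro2 prefix only; no sorry; axioms ⊆ {propext, Classical.choice,
Quot.sound}.
-/

namespace Summit.Ventures.HodgeRepro2.T5SU11JacobiMeanPhaseRate

open MeasureTheory MeasureTheory.Measure Metric Set Filter Topology
open T5SU11Unimodular T5SU11Fibration T5SU11Cartan T5SU11OneParameter T5SU11CartanProjection T5HaarCircle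
  T5BergmanCoefficient T5SU11FibrationHaar T5SU11SphericalFunction T5SU11SphericalSymmetry
  T5SU11SphericalBounds T5SU11SphericalContinuous T5SU11JacobiIwasawa T5SU11JacobiTransform
  T5SU11JacobiWeight T5SU11KFiniteMajorantPow T5SU11JacobiLaplacePhase T5SU11PhaseLawLintegral
  T5SU11JacobiWeightDerivAll T5SU11JacobiPhaseLipschitz T5SU11JacobiPhaseLawRate
open scoped Real

/-! ### Euler integrals and integrability -/

/-- `sⁿ e^{−rs}` is integrable on `(0, ∞)` for `r > 0`. -/
theorem integrableOn_pow_mul_exp_neg_mul_Ioi' (n : ℕ) {r : ℝ} (hr : 0 < r) :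
    IntegrableOn (fun s : ℝ => s ^ n * Real.exp (-(r * s))) (Ioi 0) := by
  refine (integrableOn_pow_mul_exp_neg n (k := r + 2) (by linarith)).congr_fun (fun s _ => ?_)
    measurableSet_Ioi
  simp only
  rw [mul_assoc, ← Real.exp_add]
  congr 2
  ring

/-- `sⁿ e^{−rs} (1 − c s)` is integrable on `(0, ∞)` for `r > 0`. -/
theorem integrableOn_pow_mul_exp_neg_mul_one_sub_Ioi (n : ℕ) {r : ℝ} (hr : 0 < r) (c : ℝ) :
    IntegrableOn (fun s : ℝ => s ^ n * Real.exp (-(r * s)) * (1 - c * s)) (Ioi 0) := by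
  have h1 := integrableOn_pow_mul_exp_neg_mul_Ioi' n hr
  have h2 := (integrableOn_pow_mul_exp_neg_mul_Ioi' (n + 1) hr).const_mul c
  refine (h1.sub h2).congr_fun (fun s _ => ?_) measurableSet_Ioi
  simp only [Pi.sub_apply, pow_succ]
  ring

section measure

variable [MeasurableSpace Circle] [BorelSpace Circle]

/-- `sⁿ e^{−(k−2)s} Φ_λ(s)` is integrable on `(0, ∞)` for `k > 2`, `0 ≤ λ ≤ 2` (dominated by `sⁿ e^{−(k−2)s}`). -/
theorem integrableOn_pow_mul_exp_mul_sphPhase (n : ℕ) {k lam : ℝ} (hk : 2 < k) (h0 : 0 ≤ lam)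
    (h2 : lam ≤ 2) :
    IntegrableOn (fun s : ℝ => s ^ n * Real.exp (-((k - 2) * s)) * sphPhase lam s) (Ioi 0) := by
  have hr : 0 < k - 2 := by linarith
  refine (integrableOn_pow_mul_exp_neg_mul_Ioi' n hr).mono' ?_ ?_
  · exact (((continuous_id.pow n).mul (Real.continuous_exp.comp
      (continuous_const.mul continuous_id).neg)).mul (continuous_sphPhase lam)).aestronglyMeasurable
  · filter_upwards [ae_restrict_mem measurableSet_Ioi] with s hs
    have hs0 : 0 ≤ s := le_of_lt hs
    rw [Real.norm_of_nonneg (mul_nonneg (mul_nonneg (pow_nonneg hs0 n) (Real.exp_pos _).le)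
      (sphPhase_pos lam s).le)]
    exact mul_le_of_le_one_right (mul_nonneg (pow_nonneg hs0 n) (Real.exp_pos _).le)
      (sphPhase_le_one h0 h2 s)

/-! ### The moment integrals pinned -/

/-- **The upper bound**: for `k > 2`, `0 ≤ λ ≤ 2`, `∫_0^∞ sⁿ e^{−(k−2)s} Φ_λ(s) ds ≤ n!/(k − 2)^{n+1}`. -/
theorem moment_phase_le (n : ℕ) {k lam : ℝ} (hk : 2 < k) (h0 : 0 ≤ lam) (h2 : lam ≤ 2) :
    ∫ s in Ioi (0 : ℝ), s ^ n * Real.exp (-((k - 2) * s)) * sphPhase lam s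
      ≤ (n.factorial : ℝ) / (k - 2) ^ (n + 1) := by
  have hr : 0 < k - 2 := by linarith
  rw [← integral_pow_mul_exp_neg_mul_Ioi n hr]
  refine setIntegral_mono_on (integrableOn_pow_mul_exp_mul_sphPhase n hk h0 h2)
    (integrableOn_pow_mul_exp_neg_mul_Ioi' n hr) measurableSet_Ioi fun s hs => ?_
  have hs0 : 0 ≤ s := le_of_lt hs
  exact mul_le_of_le_one_right (mul_nonneg (pow_nonneg hs0 n) (Real.exp_pos _).le)
    (sphPhase_le_one h0 h2 s)

/-- **The lower bound**: for `k > 2`, `0 ≤ λ ≤ 2`, with `c = λ(2 − λ)/2`,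
`n!/(k − 2)^{n+1} − c (n + 1)!/(k − 2)^{n+2} ≤ ∫_0^∞ sⁿ e^{−(k−2)s} Φ_λ(s) ds`. -/
theorem le_moment_phase (n : ℕ) {k lam : ℝ} (hk : 2 < k) (h0 : 0 ≤ lam) (h2 : lam ≤ 2) :
    (n.factorial : ℝ) / (k - 2) ^ (n + 1) - lam * (2 - lam) / 2 * ((n + 1).factorial : ℝ) / (k - 2) ^ (n + 2)
      ≤ ∫ s in Ioi (0 : ℝ), s ^ n * Real.exp (-((k - 2) * s)) * sphPhase lam s := by
  have hr : 0 < k - 2 := by linarith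
  set c : ℝ := lam * (2 - lam) / 2 with hc
  have hval : ∫ s in Ioi (0 : ℝ), s ^ n * Real.exp (-((k - 2) * s)) * (1 - c * s)
      = (n.factorial : ℝ) / (k - 2) ^ (n + 1) - c * ((n + 1).factorial : ℝ) / (k - 2) ^ (n + 2) := by
    have e : ∀ s : ℝ, s ^ n * Real.exp (-((k - 2) * s)) * (1 - c * s)
        = s ^ n * Real.exp (-((k - 2) * s)) - c * (s ^ (n + 1) * Real.exp (-((k - 2) * s))) := fun s => by
      rw [pow_succ]
      ring
    simp_rw [e]
    rw [integral_sub (integrableOn_pow_mul_exp_neg_mul_Ioi' n hr)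
      ((integrableOn_pow_mul_exp_neg_mul_Ioi' (n + 1) hr).const_mul c), integral_const_mul,
      integral_pow_mul_exp_neg_mul_Ioi n hr, integral_pow_mul_exp_neg_mul_Ioi (n + 1) hr]
    ring
  rw [← hval]
  refine setIntegral_mono_on (integrableOn_pow_mul_exp_neg_mul_one_sub_Ioi n hr c)
    (integrableOn_pow_mul_exp_mul_sphPhase n hk h0 h2) measurableSet_Ioi fun s hs => ?_
  have hs0 : 0 ≤ s := le_of_lt hs
  exact mul_le_mul_of_nonneg_left (one_sub_mul_le_sphPhase h0 h2 hs0)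
    (mul_nonneg (pow_nonneg hs0 n) (Real.exp_pos _).le)

/-! ### The normalised moments on the group -/

/-- **The normalised moments in the phase variable**: for `k > 2`, `0 ≤ λ ≤ 2`,
`⟨(log|a|)ⁿ⟩_{k,λ} = ∫_0^∞ sⁿ e^{−(k−2)s} Φ_λ(s) ds / ∫_0^∞ e^{−(k−2)s} Φ_λ(s) ds`. -/
theorem normalized_moment_eq_phase (n : ℕ) {k lam : ℝ} (hk : 2 < k) (h0 : 0 ≤ lam) (h2 : lam ≤ 2) :
    (∫ g, Real.log ‖mat g 0 0‖ ^ n * ((1 - ‖orbit g‖ ^ 2) ^ (k / 2) * sph lam g) ∂(nu haarCircle))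
        / (∫ g, (1 - ‖orbit g‖ ^ 2) ^ (k / 2) * sph lam g ∂(nu haarCircle))
      = (∫ s in Ioi (0 : ℝ), s ^ n * Real.exp (-((k - 2) * s)) * sphPhase lam s)
        / ∫ s in Ioi (0 : ℝ), Real.exp (-((k - 2) * s)) * sphPhase lam s := by
  rw [integral_log_pow_mul_orbit_rpow_mul_sph_eq_phase lam n (by linarith) (by linarith) (by linarith),
    jacobi_eq_laplace_phase (by linarith) (by linarith) (by linarith),
    mul_div_mul_left _ _ (by positivity : (2 * π : ℝ) ≠ 0)]

/-- **The normalised moment from above**: for `k ≥ 3`, `0 ≤ λ ≤ 2`,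
`⟨(log|a|)ⁿ⟩_{k,λ} ≤ n!/((k − 2)ⁿ (1 − c/(k − 2)))`, `c = λ(2 − λ)/2`. -/
theorem normalized_moment_le (n : ℕ) {k lam : ℝ} (hk : 3 ≤ k) (h0 : 0 ≤ lam) (h2 : lam ≤ 2) :
    (∫ g, Real.log ‖mat g 0 0‖ ^ n * ((1 - ‖orbit g‖ ^ 2) ^ (k / 2) * sph lam g) ∂(nu haarCircle))
        / (∫ g, (1 - ‖orbit g‖ ^ 2) ^ (k / 2) * sph lam g ∂(nu haarCircle))
      ≤ (n.factorial : ℝ) / ((k - 2) ^ n * (1 - lam * (2 - lam) / 2 / (k - 2))) := by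
  have hk2 : 2 < k := by linarith
  have hr : 0 < k - 2 := by linarith
  rw [normalized_moment_eq_phase n hk2 h0 h2]
  set c : ℝ := lam * (2 - lam) / 2 with hc
  have hc0 : 0 ≤ c := by rw [hc]; nlinarith
  have hc1 : c ≤ 1 / 2 := by rw [hc]; nlinarith [sq_nonneg (lam - 1)]
  have hden : 0 < 1 - c / (k - 2) := by
    have : c / (k - 2) ≤ 1 / 2 := by
      rw [div_le_iff₀ hr]
      linarith
    linarith
  have hN0 : Real.exp (-((k - 2) * 0)) * (1 - c * (0 + 1 / (k - 2))) / (k - 2)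
      ≤ ∫ s in Ioi (0 : ℝ), Real.exp (-((k - 2) * s)) * sphPhase lam s := le_tail hk2 h0 h2 le_rfl
  simp only [mul_zero, neg_zero, Real.exp_zero, one_mul, zero_add, mul_one_div] at hN0
  have hN0pos := tail_zero_pos hk2 h0 h2
  have hA := moment_phase_le n hk2 h0 h2
  rw [div_le_div_iff₀ hN0pos (by positivity)]
  calc (∫ s in Ioi (0 : ℝ), s ^ n * Real.exp (-((k - 2) * s)) * sphPhase lam s)
        * ((k - 2) ^ n * (1 - c / (k - 2)))
      ≤ (n.factorial : ℝ) / (k - 2) ^ (n + 1) * ((k - 2) ^ n * (1 - c / (k - 2))) :=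
        mul_le_mul_of_nonneg_right hA (by positivity)
    _ = (n.factorial : ℝ) * ((1 - c / (k - 2)) / (k - 2)) := by
        rw [pow_succ]
        field_simp
    _ ≤ (n.factorial : ℝ) * ∫ s in Ioi (0 : ℝ), Real.exp (-((k - 2) * s)) * sphPhase lam s :=
        mul_le_mul_of_nonneg_left hN0 (by positivity)

/-- **The normalised moment from below**: for `k > 2`, `0 ≤ λ ≤ 2`,
`n!/(k − 2)ⁿ − c (n + 1)!/(k − 2)^{n+1} ≤ ⟨(log|a|)ⁿ⟩_{k,λ}`, `c = λ(2 − λ)/2`. -/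
theorem le_normalized_moment (n : ℕ) {k lam : ℝ} (hk : 2 < k) (h0 : 0 ≤ lam) (h2 : lam ≤ 2) :
    (n.factorial : ℝ) / (k - 2) ^ n - lam * (2 - lam) / 2 * ((n + 1).factorial : ℝ) / (k - 2) ^ (n + 1)
      ≤ (∫ g, Real.log ‖mat g 0 0‖ ^ n * ((1 - ‖orbit g‖ ^ 2) ^ (k / 2) * sph lam g) ∂(nu haarCircle))
        / (∫ g, (1 - ‖orbit g‖ ^ 2) ^ (k / 2) * sph lam g ∂(nu haarCircle)) := by
  have hr : 0 < k - 2 := by linarith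
  rw [normalized_moment_eq_phase n hk h0 h2]
  have hL := le_moment_phase n hk h0 h2
  set c : ℝ := lam * (2 - lam) / 2 with hc
  have hN0 := tail_le hk h0 h2 (le_refl (0 : ℝ))
  simp only [mul_zero, neg_zero, Real.exp_zero] at hN0
  have hN0pos := tail_zero_pos hk h0 h2
  set L : ℝ := (n.factorial : ℝ) / (k - 2) ^ n - c * ((n + 1).factorial : ℝ) / (k - 2) ^ (n + 1) with hL'
  have hLr : L / (k - 2) = (n.factorial : ℝ) / (k - 2) ^ (n + 1) - c * ((n + 1).factorial : ℝ) / (k - 2) ^ (n + 2) := by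
    rw [hL']
    field_simp
    ring
  rw [le_div_iff₀ hN0pos]
  rcases le_or_gt 0 L with hL0 | hL0
  · calc L * ∫ s in Ioi (0 : ℝ), Real.exp (-((k - 2) * s)) * sphPhase lam s
        ≤ L * (1 / (k - 2)) := mul_le_mul_of_nonneg_left hN0 hL0
      _ = L / (k - 2) := by ring
      _ ≤ _ := by rw [hLr]; exact hL
  · calc L * ∫ s in Ioi (0 : ℝ), Real.exp (-((k - 2) * s)) * sphPhase lam s ≤ 0 :=
          mul_nonpos_of_nonpos_of_nonneg hL0.le hN0pos.le
      _ ≤ _ := setIntegral_nonneg measurableSet_Ioi fun s hs =>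
          mul_nonneg (mul_nonneg (pow_nonneg (le_of_lt hs) n) (Real.exp_pos _).le) (sphPhase_pos lam s).le

/-! ### The rates for the mean and the second moment -/

/-- **THE RATE OF THE MEAN PHASE**: for `k ≥ 4`, `0 ≤ λ ≤ 2`, `|k ⟨log|a|⟩_{k,λ} − 1| ≤ 7/k`. -/
theorem abs_mul_mean_phase_sub_one_le {k lam : ℝ} (hk : 4 ≤ k) (h0 : 0 ≤ lam) (h2 : lam ≤ 2) :
    |k * ((∫ g, Real.log ‖mat g 0 0‖ * ((1 - ‖orbit g‖ ^ 2) ^ (k / 2) * sph lam g) ∂(nu haarCircle))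
        / (∫ g, (1 - ‖orbit g‖ ^ 2) ^ (k / 2) * sph lam g ∂(nu haarCircle))) - 1| ≤ 7 / k := by
  have hk2 : 2 < k := by linarith
  have hk0 : 0 < k := by linarith
  have hr : 0 < k - 2 := by linarith
  have hup := normalized_moment_le 1 (k := k) (lam := lam) (by linarith) h0 h2
  have hlo := le_normalized_moment 1 hk2 h0 h2
  simp only [pow_one, Nat.factorial_one, Nat.cast_one, Nat.reduceAdd, Nat.factorial_two, Nat.cast_ofNat] at hup hlo
  set c : ℝ := lam * (2 - lam) / 2 with hc
  have hc0 : 0 ≤ c := by rw [hc]; nlinarith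
  have hc1 : c ≤ 1 / 2 := by rw [hc]; nlinarith [sq_nonneg (lam - 1)]
  set m : ℝ := (∫ g, Real.log ‖mat g 0 0‖ * ((1 - ‖orbit g‖ ^ 2) ^ (k / 2) * sph lam g) ∂(nu haarCircle))
    / (∫ g, (1 - ‖orbit g‖ ^ 2) ^ (k / 2) * sph lam g ∂(nu haarCircle)) with hm
  -- upper: `k m ≤ k/(k − 2 − c) ≤ 1 + 7/k`
  have hden : 0 < k - 2 - c := by linarith
  have hup' : m ≤ 1 / (k - 2 - c) := by
    refine hup.trans (le_of_eq ?_)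
    field_simp
  have hU : k * m - 1 ≤ 7 / k := by
    have : k * (1 / (k - 2 - c)) - 1 = (2 + c) / (k - 2 - c) := by
      field_simp
      ring
    have h3 : (2 + c) / (k - 2 - c) ≤ 7 / k := by
      rw [div_le_div_iff₀ hden hk0]
      nlinarith
    nlinarith [mul_le_mul_of_nonneg_left hup' hk0.le]
  -- lower: `k m ≥ k/(k − 2) − 2ck/(k − 2)² ≥ 1 − 4/k`
  have hL : 1 - k * m ≤ 7 / k := by
    have h1 : 1 / (k - 2) - c * 2 / (k - 2) ^ 2 ≤ m := hlo
    have h2' : 1 - k * (1 / (k - 2) - c * 2 / (k - 2) ^ 2) ≤ 4 / k := by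
      have e : 1 - k * (1 / (k - 2) - c * 2 / (k - 2) ^ 2) = (2 * c * k - 2 * (k - 2)) / (k - 2) ^ 2 := by
        field_simp
        ring
      rw [e, div_le_div_iff₀ (by positivity) hk0]
      nlinarith
    have h4 : (4 : ℝ) / k ≤ 7 / k := by
      apply div_le_div_of_nonneg_right _ hk0.le
      norm_num
    nlinarith [mul_le_mul_of_nonneg_left h1 hk0.le]
  rw [abs_le]
  constructor <;> linarith

/-- **THE RATE OF THE SECOND MOMENT**: for `k ≥ 4`, `0 ≤ λ ≤ 2`, `|k² ⟨(log|a|)²⟩_{k,λ} − 2| ≤ 48/k`. -/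
theorem abs_sq_mul_second_moment_sub_two_le {k lam : ℝ} (hk : 4 ≤ k) (h0 : 0 ≤ lam) (h2 : lam ≤ 2) :
    |k ^ 2 * ((∫ g, Real.log ‖mat g 0 0‖ ^ 2 * ((1 - ‖orbit g‖ ^ 2) ^ (k / 2) * sph lam g) ∂(nu haarCircle))
        / (∫ g, (1 - ‖orbit g‖ ^ 2) ^ (k / 2) * sph lam g ∂(nu haarCircle))) - 2| ≤ 48 / k := by
  have hk2 : 2 < k := by linarith
  have hk0 : 0 < k := by linarith
  have hr : 0 < k - 2 := by linarith
  have hup := normalized_moment_le 2 (k := k) (lam := lam) (by linarith) h0 h2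
  have hlo := le_normalized_moment 2 hk2 h0 h2
  have hf3 : ((2 + 1).factorial : ℝ) = 6 := by norm_num [Nat.factorial]
  simp only [Nat.factorial_two, Nat.cast_ofNat, hf3, Nat.reduceAdd] at hup hlo
  set c : ℝ := lam * (2 - lam) / 2 with hc
  have hc0 : 0 ≤ c := by rw [hc]; nlinarith
  have hc1 : c ≤ 1 / 2 := by rw [hc]; nlinarith [sq_nonneg (lam - 1)]
  set m : ℝ := (∫ g, Real.log ‖mat g 0 0‖ ^ 2 * ((1 - ‖orbit g‖ ^ 2) ^ (k / 2) * sph lam g) ∂(nu haarCircle))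
    / (∫ g, (1 - ‖orbit g‖ ^ 2) ^ (k / 2) * sph lam g ∂(nu haarCircle)) with hm
  have hden : 0 < k - 2 - c := by linarith
  -- upper: `k² m ≤ 2k²/((k−2)(k−2−c)) ≤ 2 + 48/k`
  have hup' : m ≤ 2 / ((k - 2) * (k - 2 - c)) := by
    refine hup.trans (le_of_eq ?_)
    field_simp
  have hU : k ^ 2 * m - 2 ≤ 48 / k := by
    have e : k ^ 2 * (2 / ((k - 2) * (k - 2 - c))) - 2
        = 2 * (4 * k - 4 + (k - 2) * c) / ((k - 2) * (k - 2 - c)) := by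
      field_simp
      ring
    have h3 : 2 * (4 * k - 4 + (k - 2) * c) / ((k - 2) * (k - 2 - c)) ≤ 48 / k := by
      rw [div_le_div_iff₀ (by positivity) hk0]
      nlinarith
    nlinarith [mul_le_mul_of_nonneg_left hup' (by positivity : (0 : ℝ) ≤ k ^ 2)]
  -- lower: `k² m ≥ 2k²/(k−2)² − 6ck²/(k−2)³ ≥ 2 − 24/k`
  have hL : 2 - k ^ 2 * m ≤ 48 / k := by
    have h1 : 2 / (k - 2) ^ 2 - c * 6 / (k - 2) ^ 3 ≤ m := hlo
    have h2' : 2 - k ^ 2 * (2 / (k - 2) ^ 2 - c * 6 / (k - 2) ^ 3) ≤ 24 / k := by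
      have e : 2 - k ^ 2 * (2 / (k - 2) ^ 2 - c * 6 / (k - 2) ^ 3)
          = (6 * c * k ^ 2 - 8 * (k - 1) * (k - 2)) / (k - 2) ^ 3 := by
        field_simp
        ring
      rw [e, div_le_div_iff₀ (by positivity) hk0]
      have hc' : 6 * c * k ^ 2 * k ≤ 3 * k ^ 2 * k := by
        have : 6 * c ≤ 3 := by linarith
        have hk3 : (0 : ℝ) ≤ k ^ 2 * k := by positivity
        nlinarith
      have hp : 0 ≤ (k - 4) * (5 * k - 4) * k := by
        apply mul_nonneg (mul_nonneg _ _) hk0.le <;> linarith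
      have hq : 0 ≤ (k - 2) ^ 3 := by positivity
      nlinarith [hc', hp, hq]
    have h4 : (24 : ℝ) / k ≤ 48 / k := by
      apply div_le_div_of_nonneg_right _ hk0.le
      norm_num
    nlinarith [mul_le_mul_of_nonneg_left h1 (by positivity : (0 : ℝ) ≤ k ^ 2)]
  rw [abs_le]
  constructor <;> linarith

/-- **THE RATE OF THE VARIANCE**: for `k ≥ 4`, `0 ≤ λ ≤ 2`, `|k² Var_{k,λ}(log|a|) − 1| ≤ 75/k`
(`T5SU11JacobiWeightDerivAsymptotic` has `k² Var → 1`). -/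
theorem abs_sq_mul_variance_phase_sub_one_le {k lam : ℝ} (hk : 4 ≤ k) (h0 : 0 ≤ lam) (h2 : lam ≤ 2) :
    |k ^ 2 * ((∫ g, Real.log ‖mat g 0 0‖ ^ 2 * ((1 - ‖orbit g‖ ^ 2) ^ (k / 2) * sph lam g) ∂(nu haarCircle))
          / (∫ g, (1 - ‖orbit g‖ ^ 2) ^ (k / 2) * sph lam g ∂(nu haarCircle))
        - ((∫ g, Real.log ‖mat g 0 0‖ * ((1 - ‖orbit g‖ ^ 2) ^ (k / 2) * sph lam g) ∂(nu haarCircle))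
          / (∫ g, (1 - ‖orbit g‖ ^ 2) ^ (k / 2) * sph lam g ∂(nu haarCircle))) ^ 2) - 1| ≤ 75 / k := by
  have hk0 : 0 < k := by linarith
  have hA := abs_sq_mul_second_moment_sub_two_le hk h0 h2
  have hB := abs_mul_mean_phase_sub_one_le hk h0 h2
  set M2 : ℝ := (∫ g, Real.log ‖mat g 0 0‖ ^ 2 * ((1 - ‖orbit g‖ ^ 2) ^ (k / 2) * sph lam g) ∂(nu haarCircle))
    / (∫ g, (1 - ‖orbit g‖ ^ 2) ^ (k / 2) * sph lam g ∂(nu haarCircle)) with hM2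
  set M1 : ℝ := (∫ g, Real.log ‖mat g 0 0‖ * ((1 - ‖orbit g‖ ^ 2) ^ (k / 2) * sph lam g) ∂(nu haarCircle))
    / (∫ g, (1 - ‖orbit g‖ ^ 2) ^ (k / 2) * sph lam g ∂(nu haarCircle)) with hM1
  have e : k ^ 2 * (M2 - M1 ^ 2) - 1 = (k ^ 2 * M2 - 2) - ((k * M1) ^ 2 - 1) := by ring
  have hk1 : 7 / k ≤ 7 / 4 := by
    rw [div_le_div_iff₀ hk0 (by norm_num : (0 : ℝ) < 4)]
    linarith
  -- `|(k M₁)² − 1| = |k M₁ − 1| · |k M₁ + 1| ≤ (7/k)(2 + 7/k) ≤ 27/k`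
  have hC : |(k * M1) ^ 2 - 1| ≤ 27 / k := by
    rw [show (k * M1) ^ 2 - 1 = (k * M1 - 1) * (k * M1 + 1) by ring, abs_mul]
    have h1 : |k * M1 + 1| ≤ 2 + 7 / k := by
      rw [show k * M1 + 1 = (k * M1 - 1) + 2 by ring]
      calc |k * M1 - 1 + 2| ≤ |k * M1 - 1| + |(2 : ℝ)| := abs_add_le _ _
        _ ≤ 7 / k + 2 := by rw [abs_two]; linarith
        _ = 2 + 7 / k := by ring
    calc |k * M1 - 1| * |k * M1 + 1| ≤ 7 / k * (2 + 7 / k) :=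
          mul_le_mul hB h1 (abs_nonneg _) (by positivity)
      _ ≤ 7 / k * (2 + 7 / 4) := mul_le_mul_of_nonneg_left (by linarith) (by positivity)
      _ ≤ 27 / k := by
          rw [show 7 / k * (2 + 7 / 4) = 7 * (15 / 4) / k by ring]
          apply div_le_div_of_nonneg_right _ hk0.le
          norm_num
  rw [e]
  calc |(k ^ 2 * M2 - 2) - ((k * M1) ^ 2 - 1)| ≤ |k ^ 2 * M2 - 2| + |(k * M1) ^ 2 - 1| := abs_sub _ _
    _ ≤ 48 / k + 27 / k := add_le_add hA hC
    _ = 75 / k := by ring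

end measure

end Summit.Ventures.HodgeRepro2.T5SU11JacobiMeanPhaseRate
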